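import Summits.Ventures.LatticeQCDFlow.Exactness.FlowSamplerOddObservableExact
import Summits.Ventures.LatticeQCDFlow.Exactness.Phi4FlowSquareIntegrable
import Summits.Ventures.LatticeQCDFlow.Exactness.Phi4FlowSignMagnetisation
import Summits.Ventures.LatticeQCDFlow.Exactness.IMHTauIntExact
import HarnessLib

/-!
# Row 2's FLOW ARM with a `Z₂`-SYMMETRIC model density: the magnetisation's autocorrelations are EXACTLY its sticking moments, `ρ_M(k) = E_{M²}[rᵏ]/E[M²]` and `τ_int(M) = ½ + E_{M²}[r/(1 − r)]/E[M²]`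

HONEST FRAMING: exact (Metropolis-corrected) sampling algorithms for lattice gauge theory;
figures of merit are autocorrelation/cost numbers at stated couplings and volumes; no
continuum-physics claim.  (SCALAR calibration rung S0-A: not a gauge result.)

Venture `LatticeQCDFlow` (cell pub-lqcd), topic `Exactness`; FANOUT row 2 (`s0-phi4`, FLOW arm
`K = imhOpPhi4 J λ q̃`).  NEW WORK of the cell: the lattice instance of
`FlowSamplerOddObservableExact` (a symmetry of reference measure, target and model makes the exact
flow sampler DIAGONAL on odd observables).  The φ⁴ action is even (`gibbsWeight_neg`, every `λ`, `J`),
Lebesgue measure on `ℝ^Λ` is negation invariant (`isNegInvariant_volume_pi`), the magnetisation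
`M = Σ_x φ_x` is odd; the ONE hypothesis on the flow is `Z₂` symmetry of its density,
`q̃(−φ) = q̃(φ)` (flows with `Z₂`-equivariant coupling layers, or any proposal symmetrised as
`½(q̃(φ) + q̃(−φ))`).  Nothing is cited as a fact.

## What is proved (`Λ = Fin (n+1)`, `λ > 0`, real `J`, `q̃ > 0` measurable, `∫ q̃ = 1`,
`q̃(−φ) = q̃(φ)`; `r(φ) = ∫ (1 − α(φ,φ')) q̃(φ') dφ'` the rejection probability from `φ`)

* `integral_magnetisation_mul_gibbsWeight`, `gibbsExpect_magnetisation` — `⟨M⟩ = 0`;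
* **`phi4Flow_odd_iterate_eq`** — for every ODD measurable `f` with `f e^{−S} ∈ L¹` (`f(−φ) = −f(φ)`):
  `(Kᵏ f)(φ) = r(φ)ᵏ f(φ)` for all `k`, `φ` — an accepted proposal forgets the sign completely;
* **`phi4Flow_autocov_magnetisation_eq_sticking`** — `∫ M̃ (Kᵏ M̃) e^{−S} = ∫ M̃² e^{−S} rᵏ` EXACTLY
  at every lag (`M̃ = M − ⟨M⟩ = M`), and the normalised form `ρ_M(k) = E_{M̃²}[rᵏ]/E[M̃²]`;
* **`phi4Flow_tauInt_magnetisation_eq`** — if `∫ M̃² e^{−S} r/(1 − r) < ∞` then the autocorrelation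
  series of `M` is summable and **`τ_int(M) = ½ + (∫ M̃² e^{−S} r/(1 − r))/∫ M̃² e^{−S} = ½ + S_M`**:
  the summed sticking floor of `Phi4FlowSquareIntegrableSticking` and the lower end of the bracket of
  `Phi4FlowSquareIntegrableBracket` are ATTAINED; the flow arm's `τ_int(M)` IS the `M̃²`-weighted mean
  number of consecutive rejections plus one half — a functional of the per-configuration rejection
  probability alone (estimable from model draws), with no chain needed;
* **`phi4Flow_tauInt_eq_of_odd_poly`**, `integral_odd_mul_gibbsWeight` — the same for every ODD
  `f ∈ PolyObs` (`Σφ³`, staggered magnetisation, …), `⟨f⟩ = 0`;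
* **`imhOp_summable_iff_of_odd`** (general) / **`phi4Flow_magnetisation_summable_iff`** — THE
  DICHOTOMY: the series of an odd observable under a symmetric flow is summable IFF its sticking
  column `∫ g² w r/(1 − r)` is finite (`τ_int(M) < ∞ ⇔ S_M < ∞`; monotone convergence, the tree's
  `integrable_of_monotone_integral_le`).

Reading for S0-A (no numerics implied): for a `Z₂`-symmetric flow the ONLY mechanism by which the
magnetisation stays correlated under the exact flow sampler is rejection runs; tunnelling between the
two wells costs nothing beyond acceptance.  For a NON-symmetric flow the jump term is nonzero and
`τ_int(M)` exceeds `½ + S_M` (bracket of `Phi4FlowSquareIntegrableBracket`).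
NOT CLAIMED: symmetry of any trained network (hypothesis); anything for even observables (`M²`, the
energy); any value of `r`, `S_M` for any run; anything for the HMC / local arms.
-/

namespace Summit.Ventures.LatticeQCDFlow.Exactness

open Real MeasureTheory Filter Finset Set Topology
open Summit.Ventures.LatticeQCDFlow.Scoring

/-! ## §0 General space: summability of an odd observable's series ⇔ finiteness of its sticking column -/

section General

variable {X : Type*} [MeasurableSpace X] {μ : Measure X} [SFinite μ] {w q : X → ℝ} {σ : X → X}

/-- **THE DICHOTOMY FOR ODD OBSERVABLES UNDER A SYMMETRIC FLOW**: with the hypotheses of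
`FlowSamplerOddObservableExact` (`σ` a symmetry of `μ`, `w`, `q`; `g` odd, measurable,
square-integrable), the autocovariance series `Σ_k C_g(k+1)` is SUMMABLE IF AND ONLY IF
`∫ g² w r/(1 − r) < ∞` (bounded monotone partial sums `∫ g² w Σ_{k<N} r^{k+1}` force the limit to be
integrable, the tree's `integrable_of_monotone_integral_le`; the converse is
`imhOp_hasSum_autocov_of_odd`).  So `τ_int(g) < ∞ ⇔ S_g < ∞`, and then `τ_int(g) = ½ + S_g`. -/
theorem imhOp_summable_iff_of_odd (hw0 : ∀ t, 0 < w t) (hwm : Measurable w) (hwi : Integrable w μ)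
    (hq0 : ∀ t, 0 < q t) (hqm : Measurable q) (hqi : Integrable q μ) (hq1 : ∫ t, q t ∂μ = 1)
    (hσ : ∀ F : X → ℝ, ∫ x, F (σ x) ∂μ = ∫ x, F x ∂μ) (hw : ∀ t, w (σ t) = w t)
    (hq : ∀ t, q (σ t) = q t) {g : X → ℝ} (hgm : Measurable g)
    (hg2 : Integrable (fun t => g t ^ 2 * w t) μ) (hg : ∀ t, g (σ t) = -g t) :
    (Summable fun k => ∫ t, g t * ((imhOp μ w q)^[k + 1] g) t * w t ∂μ) ↔
    Integrable (fun t => g t ^ 2 * w t * ((∫ t', (1 - imhAcceptQ w q t t') * q t' ∂μ)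
      / (1 - ∫ t', (1 - imhAcceptQ w q t t') * q t' ∂μ))) μ := by
  refine ⟨fun hs => ?_, fun hS =>
    (imhOp_hasSum_autocov_of_odd hw0 hwm hwi hq0 hqm hqi hq1 hσ hw hq hgm hg2 hg hS).summable⟩
  obtain ⟨hr0, hr1, hrm⟩ := rejection_bounds (μ := μ) hw0 hwm hq0 hqm hqi hq1
  set r : X → ℝ := fun t => ∫ t', (1 - imhAcceptQ w q t t') * q t' ∂μ with hr
  have hgw := integrable_mul_weight_of_sq (fun t => (hw0 t).le) hwm hwi hgm hg2
  have hrlt : ∀ t, r t < 1 := fun t => by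
    show (∫ t', (1 - imhAcceptQ w q t t') * q t' ∂μ) < 1
    rw [rejection_eq_rejCurve hw0 hq0 t]
    exact rejCurve_lt_one hw0 hwm hq0 hqm hqi hq1 (div_pos (hw0 t) (hq0 t))
  have hgeo : ∀ t, HasSum (fun k => r t ^ (k + 1)) (r t / (1 - r t)) := by
    intro t
    have h := (hasSum_geometric_of_lt_one (hr0 t) (hrlt t)).mul_left (r t)
    have e : r t * (1 - r t)⁻¹ = r t / (1 - r t) := by rw [div_eq_mul_inv]
    rw [e] at h
    exact h.congr_fun fun k => by ring
  have hterm : ∀ k, ∫ t, g t * ((imhOp μ w q)^[k + 1] g) t * w t ∂μ = ∫ t, g t ^ 2 * w t * r t ^ (k + 1) ∂μ :=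
    fun k => imhOp_autocov_eq_sticking_of_odd hw0 hwm hq0 hqm hqi hq1 hσ hw hq hgm hgw hg (k + 1)
  have hterm_nn : ∀ k t, 0 ≤ g t ^ 2 * w t * r t ^ (k + 1) := fun k t =>
    mul_nonneg (mul_nonneg (sq_nonneg _) (hw0 t).le) (pow_nonneg (hr0 t) _)
  have hterm_int : ∀ k, Integrable (fun t => g t ^ 2 * w t * r t ^ (k + 1)) μ := by
    intro k
    refine Integrable.mono' hg2 (((hgm.pow_const 2).mul hwm).mul (hrm.pow_const _)).aestronglyMeasurable
      (Eventually.of_forall fun t => ?_)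
    rw [Real.norm_eq_abs, abs_of_nonneg (hterm_nn k t)]
    exact mul_le_of_le_one_right (mul_nonneg (sq_nonneg _) (hw0 t).le) (pow_le_one₀ (hr0 t) (hr1 t))
  have hnn : ∀ k, 0 ≤ ∫ t, g t * ((imhOp μ w q)^[k + 1] g) t * w t ∂μ := fun k => by
    rw [hterm k]; exact integral_nonneg fun t => hterm_nn k t
  -- the monotone partial-sum integrands and their bounded integrals
  set f : ℕ → X → ℝ := fun N t => g t ^ 2 * w t * ∑ k ∈ Finset.range N, r t ^ (k + 1) with hf
  have hfi : ∀ N, Integrable (f N) μ := by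
    intro N
    have e : f N = fun t => ∑ k ∈ Finset.range N, g t ^ 2 * w t * r t ^ (k + 1) := by
      funext t; simp only [hf, Finset.mul_sum]
    rw [e]; exact integrable_finsetSum _ fun k _ => hterm_int k
  have hf0 : ∀ N, 0 ≤ᵐ[μ] f N := fun N => Eventually.of_forall fun t =>
    mul_nonneg (mul_nonneg (sq_nonneg _) (hw0 t).le) (Finset.sum_nonneg fun k _ => pow_nonneg (hr0 t) _)
  have hmono : ∀ᵐ t ∂μ, Monotone fun N => f N t := Eventually.of_forall fun t => by
    intro N N' hNN'
    simp only [hf]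
    exact mul_le_mul_of_nonneg_left (Finset.sum_le_sum_of_subset_of_nonneg (Finset.range_mono hNN')
      fun k _ _ => pow_nonneg (hr0 t) _) (mul_nonneg (sq_nonneg _) (hw0 t).le)
  have hlim : ∀ᵐ t ∂μ, Tendsto (fun N => f N t) atTop (𝓝 (g t ^ 2 * w t * (r t / (1 - r t)))) :=
    Eventually.of_forall fun t => ((hgeo t).tendsto_sum_nat).const_mul _
  have hle : ∀ N, ∫ t, f N t ∂μ ≤ ∑' k, ∫ t, g t * ((imhOp μ w q)^[k + 1] g) t * w t ∂μ := by
    intro N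
    have e : ∫ t, f N t ∂μ = ∑ k ∈ Finset.range N, ∫ t, g t * ((imhOp μ w q)^[k + 1] g) t * w t ∂μ := by
      simp_rw [hterm]
      rw [← integral_finsetSum _ fun k _ => hterm_int k]
      refine integral_congr_ae (Eventually.of_forall fun t => ?_)
      simp only [hf, Finset.mul_sum]
    rw [e]
    exact hs.sum_le_tsum (Finset.range N) fun k _ => hnn k
  exact (integrable_of_monotone_integral_le hfi hf0 hmono hlim hle).1

end General

section Lattice

variable {n : ℕ}

/-- **`∫ M e^{−S} = 0`**: the magnetisation is odd, the Gibbs weight even, Lebesgue measure negation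
invariant (no null-set argument needed: `M(−φ) e^{−S(−φ)} = −M(φ) e^{−S(φ)}` everywhere). -/
theorem integral_magnetisation_mul_gibbsWeight (J : Fin (n + 1) → Fin (n + 1) → ℝ) (lam : ℝ) :
    ∫ φ : Fin (n + 1) → ℝ, (∑ x, φ x) * gibbsWeight J lam φ = 0 := by
  haveI := isNegInvariant_volume_pi (Λ := Fin (n + 1))
  have h := integral_neg_eq_self (fun φ : Fin (n + 1) → ℝ => (∑ x, φ x) * gibbsWeight J lam φ) volume
  have e : (fun φ : Fin (n + 1) → ℝ => (∑ x, (-φ) x) * gibbsWeight J lam (-φ))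
      = fun φ => -((∑ x, φ x) * gibbsWeight J lam φ) := by
    funext φ
    simp only [Pi.neg_apply, Finset.sum_neg_distrib, gibbsWeight_neg]
    ring
  rw [e, integral_neg] at h
  linarith

/-- `⟨M⟩ = 0` in the Gibbs-expectation vocabulary. -/
theorem gibbsExpect_magnetisation (J : Fin (n + 1) → Fin (n + 1) → ℝ) (lam : ℝ) :
    gibbsExpect J lam (fun φ => ∑ x, φ x) = 0 := by
  unfold gibbsExpect
  rw [integral_magnetisation_mul_gibbsWeight, zero_div]

/-- **THE φ⁴ FLOW SAMPLER WITH A SYMMETRIC MODEL IS DIAGONAL ON ODD OBSERVABLES**: `q̃(−φ) = q̃(φ)`,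
`f` measurable, odd, `f e^{−S} ∈ L¹` ⇒ `(Kᵏ f)(φ) = r(φ)ᵏ f(φ)` for every `k` and `φ`. -/
theorem phi4Flow_odd_iterate_eq {lam : ℝ} (J : Fin (n + 1) → Fin (n + 1) → ℝ)
    {q : (Fin (n + 1) → ℝ) → ℝ} (hq0 : ∀ φ, 0 < q φ) (hqm : Measurable q) (hqi : Integrable q)
    (hq1 : ∫ φ, q φ = 1) (hqsym : ∀ φ, q (-φ) = q φ) {f : (Fin (n + 1) → ℝ) → ℝ} (hfm : Measurable f)
    (hfw : Integrable (fun φ => f φ * gibbsWeight J lam φ)) (hodd : ∀ φ, f (-φ) = -f φ) (k : ℕ)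
    (φ : Fin (n + 1) → ℝ) :
    ((imhOpPhi4 J lam q)^[k] f) φ
      = (∫ φ', (1 - imhAcceptQ (gibbsWeight J lam) q φ φ') * q φ') ^ k * f φ := by
  haveI := isNegInvariant_volume_pi (Λ := Fin (n + 1))
  rw [imhOpPhi4_eq_imhOp]
  exact imhOp_iterate_eq_of_odd (μ := volume) (σ := fun ψ : Fin (n + 1) → ℝ => -ψ)
    (fun ψ => gibbsWeight_pos J lam ψ) (continuous_gibbsWeight J lam).measurable hq0 hqm hqi hq1
    (fun F => integral_neg_eq_self F volume) (fun ψ => gibbsWeight_neg J lam ψ) hqsym k hfm hfw hodd φ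

/-- **EVERY AUTOCOVARIANCE OF THE MAGNETISATION IS EXACTLY ITS STICKING MOMENT** under a symmetric
model: with `M̃ = M − ⟨M⟩`, for every lag `k`,
`∫ M̃ (Kᵏ M̃) e^{−S} dφ = ∫ M̃² e^{−S} rᵏ dφ`. -/
theorem phi4Flow_autocov_magnetisation_eq_sticking {lam : ℝ} (hlam : 0 < lam)
    (J : Fin (n + 1) → Fin (n + 1) → ℝ) {q : (Fin (n + 1) → ℝ) → ℝ} (hq0 : ∀ φ, 0 < q φ)
    (hqm : Measurable q) (hqi : Integrable q) (hq1 : ∫ φ, q φ = 1) (hqsym : ∀ φ, q (-φ) = q φ)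
    (k : ℕ) :
    ∫ φ, ((∑ x, φ x) - gibbsExpect J lam (fun ψ => ∑ x, ψ x))
        * ((imhOpPhi4 J lam q)^[k]
            (fun ψ => (∑ x, ψ x) - gibbsExpect J lam (fun ψ => ∑ x, ψ x))) φ * gibbsWeight J lam φ
      = ∫ φ, ((∑ x, φ x) - gibbsExpect J lam (fun ψ => ∑ x, ψ x)) ^ 2 * gibbsWeight J lam φ
          * (∫ φ', (1 - imhAcceptQ (gibbsWeight J lam) q φ φ') * q φ') ^ k := by
  haveI := isNegInvariant_volume_pi (Λ := Fin (n + 1))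
  obtain ⟨hgm, hg2⟩ := polyObs_sq_integrable hlam J
    (polyObs_sub_const polyObs_magnetisation (gibbsExpect J lam (fun ψ => ∑ x, ψ x)))
  have hgw := integrable_mul_weight_of_sq (fun φ => (gibbsWeight_pos J lam φ).le)
    (continuous_gibbsWeight J lam).measurable (integrable_gibbsWeight hlam J) hgm hg2
  have hodd : ∀ φ : Fin (n + 1) → ℝ, ((∑ x, (-φ) x) - gibbsExpect J lam (fun ψ => ∑ x, ψ x))
      = -((∑ x, φ x) - gibbsExpect J lam (fun ψ => ∑ x, ψ x)) := fun φ => by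
    simp only [Pi.neg_apply, Finset.sum_neg_distrib, gibbsExpect_magnetisation]
    ring
  rw [imhOpPhi4_eq_imhOp]
  exact imhOp_autocov_eq_sticking_of_odd (μ := volume) (σ := fun ψ : Fin (n + 1) → ℝ => -ψ)
    (fun ψ => gibbsWeight_pos J lam ψ) (continuous_gibbsWeight J lam).measurable hq0 hqm hqi hq1
    (fun F => integral_neg_eq_self F volume) (fun ψ => gibbsWeight_neg J lam ψ) hqsym hgm hgw hodd k

/-- **`ρ_M(k) = E_{M̃²}[rᵏ]/E[M̃²]` EXACTLY** for every lag under a symmetric model (normalised form). -/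
theorem phi4Flow_autocorr_magnetisation_eq_sticking {lam : ℝ} (hlam : 0 < lam)
    (J : Fin (n + 1) → Fin (n + 1) → ℝ) {q : (Fin (n + 1) → ℝ) → ℝ} (hq0 : ∀ φ, 0 < q φ)
    (hqm : Measurable q) (hqi : Integrable q) (hq1 : ∫ φ, q φ = 1) (hqsym : ∀ φ, q (-φ) = q φ)
    (k : ℕ) :
    (∫ φ, ((∑ x, φ x) - gibbsExpect J lam (fun ψ => ∑ x, ψ x))
        * ((imhOpPhi4 J lam q)^[k]
            (fun ψ => (∑ x, ψ x) - gibbsExpect J lam (fun ψ => ∑ x, ψ x))) φ * gibbsWeight J lam φ)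
        / ∫ φ, ((∑ x, φ x) - gibbsExpect J lam (fun ψ => ∑ x, ψ x)) ^ 2 * gibbsWeight J lam φ
      = (∫ φ, ((∑ x, φ x) - gibbsExpect J lam (fun ψ => ∑ x, ψ x)) ^ 2 * gibbsWeight J lam φ
          * (∫ φ', (1 - imhAcceptQ (gibbsWeight J lam) q φ φ') * q φ') ^ k)
        / ∫ φ, ((∑ x, φ x) - gibbsExpect J lam (fun ψ => ∑ x, ψ x)) ^ 2 * gibbsWeight J lam φ := by
  rw [phi4Flow_autocov_magnetisation_eq_sticking hlam J hq0 hqm hqi hq1 hqsym k]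

/-- **THE EXACT INTEGRATED AUTOCORRELATION TIME OF THE MAGNETISATION UNDER A SYMMETRIC FLOW.**
Every `λ > 0`, real `J`, positive measurable model density with `∫ q̃ = 1` and `q̃(−φ) = q̃(φ)`; if
`∫ M̃² e^{−S} r/(1 − r) < ∞` then the autocorrelation series of `M` under `imhOpPhi4 J λ q̃` is summable
and **`τ_int(M) = ½ + (∫ M̃² e^{−S} r/(1 − r)) / ∫ M̃² e^{−S}`** — one half plus the `M̃²`-weighted mean
number of consecutive rejections, and nothing else. -/
theorem phi4Flow_tauInt_magnetisation_eq {lam : ℝ} (hlam : 0 < lam)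
    (J : Fin (n + 1) → Fin (n + 1) → ℝ) {q : (Fin (n + 1) → ℝ) → ℝ} (hq0 : ∀ φ, 0 < q φ)
    (hqm : Measurable q) (hqi : Integrable q) (hq1 : ∫ φ, q φ = 1) (hqsym : ∀ φ, q (-φ) = q φ)
    (hS : Integrable (fun φ : Fin (n + 1) → ℝ =>
      ((∑ x, φ x) - gibbsExpect J lam (fun ψ => ∑ x, ψ x)) ^ 2 * gibbsWeight J lam φ
        * ((∫ φ', (1 - imhAcceptQ (gibbsWeight J lam) q φ φ') * q φ')
          / (1 - ∫ φ', (1 - imhAcceptQ (gibbsWeight J lam) q φ φ') * q φ')))) :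
    (Summable fun k => (∫ φ, ((∑ x, φ x) - gibbsExpect J lam (fun ψ => ∑ x, ψ x))
        * ((imhOpPhi4 J lam q)^[k + 1]
            (fun ψ => (∑ x, ψ x) - gibbsExpect J lam (fun ψ => ∑ x, ψ x))) φ * gibbsWeight J lam φ)
        / ∫ φ, ((∑ x, φ x) - gibbsExpect J lam (fun ψ => ∑ x, ψ x)) ^ 2 * gibbsWeight J lam φ) ∧
    tauInt (fun k => (∫ φ, ((∑ x, φ x) - gibbsExpect J lam (fun ψ => ∑ x, ψ x))
        * ((imhOpPhi4 J lam q)^[k]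
            (fun ψ => (∑ x, ψ x) - gibbsExpect J lam (fun ψ => ∑ x, ψ x))) φ * gibbsWeight J lam φ)
        / ∫ φ, ((∑ x, φ x) - gibbsExpect J lam (fun ψ => ∑ x, ψ x)) ^ 2 * gibbsWeight J lam φ)
      = 1 / 2 + (∫ φ, ((∑ x, φ x) - gibbsExpect J lam (fun ψ => ∑ x, ψ x)) ^ 2 * gibbsWeight J lam φ
          * ((∫ φ', (1 - imhAcceptQ (gibbsWeight J lam) q φ φ') * q φ')
            / (1 - ∫ φ', (1 - imhAcceptQ (gibbsWeight J lam) q φ φ') * q φ')))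
        / ∫ φ, ((∑ x, φ x) - gibbsExpect J lam (fun ψ => ∑ x, ψ x)) ^ 2 * gibbsWeight J lam φ := by
  haveI := isNegInvariant_volume_pi (Λ := Fin (n + 1))
  obtain ⟨hgm, hg2⟩ := polyObs_sq_integrable hlam J
    (polyObs_sub_const polyObs_magnetisation (gibbsExpect J lam (fun ψ => ∑ x, ψ x)))
  have hodd : ∀ φ : Fin (n + 1) → ℝ, ((∑ x, (-φ) x) - gibbsExpect J lam (fun ψ => ∑ x, ψ x))
      = -((∑ x, φ x) - gibbsExpect J lam (fun ψ => ∑ x, ψ x)) := fun φ => by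
    simp only [Pi.neg_apply, Finset.sum_neg_distrib, gibbsExpect_magnetisation]
    ring
  rw [imhOpPhi4_eq_imhOp]
  exact imhOp_tauInt_eq_of_odd (μ := volume) (σ := fun ψ : Fin (n + 1) → ℝ => -ψ)
    (fun ψ => gibbsWeight_pos J lam ψ) (continuous_gibbsWeight J lam).measurable
    (integrable_gibbsWeight hlam J) hq0 hqm hqi hq1 (fun F => integral_neg_eq_self F volume)
    (fun ψ => gibbsWeight_neg J lam ψ) hqsym hgm hg2 hodd hS

/-- **THE SAME FOR EVERY ODD POLYNOMIAL OBSERVABLE** (`Σ_x φ_x³`, a staggered magnetisation, …):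
`f ∈ PolyObs` with `f(−φ) = −f(φ)` (then `⟨f⟩ = 0`), symmetric model, `∫ f² e^{−S} r/(1 − r) < ∞` ⇒ the
autocorrelation series of `f` is summable and `τ_int(f) = ½ + (∫ f² e^{−S} r/(1 − r))/∫ f² e^{−S}`. -/
theorem phi4Flow_tauInt_eq_of_odd_poly {lam : ℝ} (hlam : 0 < lam)
    (J : Fin (n + 1) → Fin (n + 1) → ℝ) {q : (Fin (n + 1) → ℝ) → ℝ} (hq0 : ∀ φ, 0 < q φ)
    (hqm : Measurable q) (hqi : Integrable q) (hq1 : ∫ φ, q φ = 1) (hqsym : ∀ φ, q (-φ) = q φ)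
    {f : (Fin (n + 1) → ℝ) → ℝ} (hf : PolyObs f) (hodd : ∀ φ, f (-φ) = -f φ)
    (hS : Integrable (fun φ : Fin (n + 1) → ℝ => f φ ^ 2 * gibbsWeight J lam φ
        * ((∫ φ', (1 - imhAcceptQ (gibbsWeight J lam) q φ φ') * q φ')
          / (1 - ∫ φ', (1 - imhAcceptQ (gibbsWeight J lam) q φ φ') * q φ')))) :
    (Summable fun k => (∫ φ, f φ * ((imhOpPhi4 J lam q)^[k + 1] f) φ * gibbsWeight J lam φ)
        / ∫ φ, f φ ^ 2 * gibbsWeight J lam φ) ∧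
    tauInt (fun k => (∫ φ, f φ * ((imhOpPhi4 J lam q)^[k] f) φ * gibbsWeight J lam φ)
        / ∫ φ, f φ ^ 2 * gibbsWeight J lam φ)
      = 1 / 2 + (∫ φ, f φ ^ 2 * gibbsWeight J lam φ
          * ((∫ φ', (1 - imhAcceptQ (gibbsWeight J lam) q φ φ') * q φ')
            / (1 - ∫ φ', (1 - imhAcceptQ (gibbsWeight J lam) q φ φ') * q φ')))
        / ∫ φ, f φ ^ 2 * gibbsWeight J lam φ := by
  haveI := isNegInvariant_volume_pi (Λ := Fin (n + 1))
  obtain ⟨hfm, hf2⟩ := polyObs_sq_integrable hlam J hf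
  rw [imhOpPhi4_eq_imhOp]
  exact imhOp_tauInt_eq_of_odd (μ := volume) (σ := fun ψ : Fin (n + 1) → ℝ => -ψ)
    (fun ψ => gibbsWeight_pos J lam ψ) (continuous_gibbsWeight J lam).measurable
    (integrable_gibbsWeight hlam J) hq0 hqm hqi hq1 (fun F => integral_neg_eq_self F volume)
    (fun ψ => gibbsWeight_neg J lam ψ) hqsym hfm hf2 hodd hS

/-- An odd observable has mean zero under the (even) Gibbs weight: `∫ f e^{−S} = 0`. -/
theorem integral_odd_mul_gibbsWeight (J : Fin (n + 1) → Fin (n + 1) → ℝ) (lam : ℝ)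
    {f : (Fin (n + 1) → ℝ) → ℝ} (hodd : ∀ φ, f (-φ) = -f φ) :
    ∫ φ : Fin (n + 1) → ℝ, f φ * gibbsWeight J lam φ = 0 := by
  haveI := isNegInvariant_volume_pi (Λ := Fin (n + 1))
  have h := integral_neg_eq_self (fun φ : Fin (n + 1) → ℝ => f φ * gibbsWeight J lam φ) volume
  have e : (fun φ : Fin (n + 1) → ℝ => f (-φ) * gibbsWeight J lam (-φ))
      = fun φ => -(f φ * gibbsWeight J lam φ) := by
    funext φ
    rw [hodd, gibbsWeight_neg]
    ring
  rw [e, integral_neg] at h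
  linarith

/-- **`τ_int(M) < ∞ ⇔ S_M < ∞` under a symmetric flow**: the autocorrelation series of the
magnetisation is summable iff `∫ M̃² e^{−S} r/(1 − r) < ∞` (and then `τ_int(M) = ½ + S_M`). -/
theorem phi4Flow_magnetisation_summable_iff {lam : ℝ} (hlam : 0 < lam)
    (J : Fin (n + 1) → Fin (n + 1) → ℝ) {q : (Fin (n + 1) → ℝ) → ℝ} (hq0 : ∀ φ, 0 < q φ)
    (hqm : Measurable q) (hqi : Integrable q) (hq1 : ∫ φ, q φ = 1) (hqsym : ∀ φ, q (-φ) = q φ) :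
    (Summable fun k => ∫ φ, ((∑ x, φ x) - gibbsExpect J lam (fun ψ => ∑ x, ψ x))
        * ((imhOpPhi4 J lam q)^[k + 1]
            (fun ψ => (∑ x, ψ x) - gibbsExpect J lam (fun ψ => ∑ x, ψ x))) φ * gibbsWeight J lam φ) ↔
    Integrable (fun φ : Fin (n + 1) → ℝ =>
      ((∑ x, φ x) - gibbsExpect J lam (fun ψ => ∑ x, ψ x)) ^ 2 * gibbsWeight J lam φ
        * ((∫ φ', (1 - imhAcceptQ (gibbsWeight J lam) q φ φ') * q φ')
          / (1 - ∫ φ', (1 - imhAcceptQ (gibbsWeight J lam) q φ φ') * q φ'))) := by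
  haveI := isNegInvariant_volume_pi (Λ := Fin (n + 1))
  obtain ⟨hgm, hg2⟩ := polyObs_sq_integrable hlam J
    (polyObs_sub_const polyObs_magnetisation (gibbsExpect J lam (fun ψ => ∑ x, ψ x)))
  have hodd : ∀ φ : Fin (n + 1) → ℝ, ((∑ x, (-φ) x) - gibbsExpect J lam (fun ψ => ∑ x, ψ x))
      = -((∑ x, φ x) - gibbsExpect J lam (fun ψ => ∑ x, ψ x)) := fun φ => by
    simp only [Pi.neg_apply, Finset.sum_neg_distrib, gibbsExpect_magnetisation]
    ring
  rw [imhOpPhi4_eq_imhOp]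
  exact imhOp_summable_iff_of_odd (μ := volume) (σ := fun ψ : Fin (n + 1) → ℝ => -ψ)
    (fun ψ => gibbsWeight_pos J lam ψ) (continuous_gibbsWeight J lam).measurable
    (integrable_gibbsWeight hlam J) hq0 hqm hqi hq1 (fun F => integral_neg_eq_self F volume)
    (fun ψ => gibbsWeight_neg J lam ψ) hqsym hgm hg2 hodd

end Lattice

end Summit.Ventures.LatticeQCDFlow.Exactness

/-! ## §3 SYMMETRISING ANY FLOW (GEN-22 append): `q̃ₛ(φ) = ½(q̃(φ) + q̃(−φ))` (propose, then flip
the sign with probability ½) is a positive normalised SYMMETRIC model density for EVERY network, so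
§§0–2 apply to it: `ρ_M(k) = E_{M̃²}[rₛᵏ]/E[M̃²]`, `τ_int(M) = ½ + S_M` exactly.  No value claimed. -/

namespace Summit.Ventures.LatticeQCDFlow.Exactness

open Real MeasureTheory Filter Finset Set Topology
open Summit.Ventures.LatticeQCDFlow.Scoring

section Symmetrised

variable {n : ℕ}

/-- **The symmetrised model density** `φ ↦ (q̃(φ) + q̃(−φ))/2` of a positive measurable `q̃` with
`∫ q̃ = 1` is positive, measurable, integrable, normalised, and `Z₂`-symmetric. -/
theorem symmetrisedDensity_facts {q : (Fin (n + 1) → ℝ) → ℝ} (hq0 : ∀ φ, 0 < q φ)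
    (hqm : Measurable q) (hqi : Integrable q) (hq1 : ∫ φ, q φ = 1) :
    (∀ φ : Fin (n + 1) → ℝ, 0 < (q φ + q (-φ)) / 2) ∧
    Measurable (fun φ : Fin (n + 1) → ℝ => (q φ + q (-φ)) / 2) ∧
    Integrable (fun φ : Fin (n + 1) → ℝ => (q φ + q (-φ)) / 2) ∧
    (∫ φ : Fin (n + 1) → ℝ, (q φ + q (-φ)) / 2 = 1) ∧
    (∀ φ : Fin (n + 1) → ℝ, (q (-φ) + q (-(-φ))) / 2 = (q φ + q (-φ)) / 2) := by
  haveI := isNegInvariant_volume_pi (Λ := Fin (n + 1))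
  have hqn : Integrable (fun φ : Fin (n + 1) → ℝ => q (-φ)) := hqi.comp_neg
  refine ⟨fun φ => div_pos (add_pos (hq0 φ) (hq0 (-φ))) two_pos,
    (hqm.add (hqm.comp measurable_neg)).div_const 2, (hqi.add hqn).div_const 2, ?_,
    fun φ => by rw [neg_neg, add_comm]⟩
  rw [integral_div, integral_add hqi hqn, integral_neg_eq_self q volume, hq1]
  norm_num

/-- **EVERY AUTOCORRELATION OF THE MAGNETISATION UNDER THE SYMMETRISED FLOW ARM IS ITS STICKING
MOMENT** (every `λ > 0`, real `J`, EVERY positive model density `q̃`, `∫ q̃ = 1`, no symmetry asked of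
`q̃`): with `q̃ₛ = ½(q̃ + q̃∘(−))` and `rₛ` its rejection probability,
`ρ_M(k) = E_{M̃²}[rₛᵏ]/E[M̃²]` at every lag `k`. -/
theorem phi4Flow_autocorr_magnetisation_eq_sticking_symmetrised {lam : ℝ} (hlam : 0 < lam)
    (J : Fin (n + 1) → Fin (n + 1) → ℝ) {q : (Fin (n + 1) → ℝ) → ℝ} (hq0 : ∀ φ, 0 < q φ)
    (hqm : Measurable q) (hqi : Integrable q) (hq1 : ∫ φ, q φ = 1) (k : ℕ) :
    (∫ φ, ((∑ x, φ x) - gibbsExpect J lam (fun ψ => ∑ x, ψ x))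
        * ((imhOpPhi4 J lam (fun ψ => (q ψ + q (-ψ)) / 2))^[k]
            (fun ψ => (∑ x, ψ x) - gibbsExpect J lam (fun ψ => ∑ x, ψ x))) φ * gibbsWeight J lam φ)
        / ∫ φ, ((∑ x, φ x) - gibbsExpect J lam (fun ψ => ∑ x, ψ x)) ^ 2 * gibbsWeight J lam φ
      = (∫ φ, ((∑ x, φ x) - gibbsExpect J lam (fun ψ => ∑ x, ψ x)) ^ 2 * gibbsWeight J lam φ
          * (∫ φ', (1 - imhAcceptQ (gibbsWeight J lam) (fun ψ => (q ψ + q (-ψ)) / 2) φ φ')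
              * ((q φ' + q (-φ')) / 2)) ^ k)
        / ∫ φ, ((∑ x, φ x) - gibbsExpect J lam (fun ψ => ∑ x, ψ x)) ^ 2 * gibbsWeight J lam φ := by
  obtain ⟨h0, hm, hi, h1, hsym⟩ := symmetrisedDensity_facts hq0 hqm hqi hq1
  exact phi4Flow_autocorr_magnetisation_eq_sticking hlam J h0 hm hi h1 hsym k

/-- **`τ_int(M) = ½ + S_M` EXACTLY FOR THE SYMMETRISED FLOW ARM OF EVERY NETWORK**: if
`∫ M̃² e^{−S} rₛ/(1 − rₛ) < ∞` then the autocorrelation series of `M` under `imhOpPhi4 J λ q̃ₛ` is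
summable and `τ_int(M) = ½ + (∫ M̃² e^{−S} rₛ/(1 − rₛ))/∫ M̃² e^{−S}` (and summable `⇔` that integral is
finite, by `phi4Flow_magnetisation_summable_iff` with `symmetrisedDensity_facts`). -/
theorem phi4Flow_tauInt_magnetisation_eq_symmetrised {lam : ℝ} (hlam : 0 < lam)
    (J : Fin (n + 1) → Fin (n + 1) → ℝ) {q : (Fin (n + 1) → ℝ) → ℝ} (hq0 : ∀ φ, 0 < q φ)
    (hqm : Measurable q) (hqi : Integrable q) (hq1 : ∫ φ, q φ = 1)
    (hS : Integrable (fun φ : Fin (n + 1) → ℝ =>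
      ((∑ x, φ x) - gibbsExpect J lam (fun ψ => ∑ x, ψ x)) ^ 2 * gibbsWeight J lam φ
        * ((∫ φ', (1 - imhAcceptQ (gibbsWeight J lam) (fun ψ => (q ψ + q (-ψ)) / 2) φ φ')
              * ((q φ' + q (-φ')) / 2))
          / (1 - ∫ φ', (1 - imhAcceptQ (gibbsWeight J lam) (fun ψ => (q ψ + q (-ψ)) / 2) φ φ')
              * ((q φ' + q (-φ')) / 2))))) :
    (Summable fun k => (∫ φ, ((∑ x, φ x) - gibbsExpect J lam (fun ψ => ∑ x, ψ x))
        * ((imhOpPhi4 J lam (fun ψ => (q ψ + q (-ψ)) / 2))^[k + 1]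
            (fun ψ => (∑ x, ψ x) - gibbsExpect J lam (fun ψ => ∑ x, ψ x))) φ * gibbsWeight J lam φ)
        / ∫ φ, ((∑ x, φ x) - gibbsExpect J lam (fun ψ => ∑ x, ψ x)) ^ 2 * gibbsWeight J lam φ) ∧
    tauInt (fun k => (∫ φ, ((∑ x, φ x) - gibbsExpect J lam (fun ψ => ∑ x, ψ x))
        * ((imhOpPhi4 J lam (fun ψ => (q ψ + q (-ψ)) / 2))^[k]
            (fun ψ => (∑ x, ψ x) - gibbsExpect J lam (fun ψ => ∑ x, ψ x))) φ * gibbsWeight J lam φ)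
        / ∫ φ, ((∑ x, φ x) - gibbsExpect J lam (fun ψ => ∑ x, ψ x)) ^ 2 * gibbsWeight J lam φ)
      = 1 / 2 + (∫ φ, ((∑ x, φ x) - gibbsExpect J lam (fun ψ => ∑ x, ψ x)) ^ 2 * gibbsWeight J lam φ
          * ((∫ φ', (1 - imhAcceptQ (gibbsWeight J lam) (fun ψ => (q ψ + q (-ψ)) / 2) φ φ')
                * ((q φ' + q (-φ')) / 2))
            / (1 - ∫ φ', (1 - imhAcceptQ (gibbsWeight J lam) (fun ψ => (q ψ + q (-ψ)) / 2) φ φ')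
                * ((q φ' + q (-φ')) / 2))))
        / ∫ φ, ((∑ x, φ x) - gibbsExpect J lam (fun ψ => ∑ x, ψ x)) ^ 2 * gibbsWeight J lam φ := by
  obtain ⟨h0, hm, hi, h1, hsym⟩ := symmetrisedDensity_facts hq0 hqm hqi hq1
  exact phi4Flow_tauInt_magnetisation_eq hlam J h0 hm hi h1 hsym hS

end Symmetrised

end Summit.Ventures.LatticeQCDFlow.Exactness
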